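/-
Copyright (c) 2026. All rights reserved.
Released under Apache 2.0 license as described in the file LICENSE.
-/
import Literature.Geometry.Kaehler.ComplexTorusQuaternionXSixKRYDegreeFormulaHurwitzForm
import Literature.Geometry.Kaehler.ComplexTorusQuaternionXSixSpecialCyclesDegreeEulerProduct
import HarnessLib

/-!
# Kudla–Rapoport–Yang's degree formula for `X₆` in Cohen's `μ·σ₁` form:
# `deg Z(t)_ℚ = 2δ(d; 6)·(h(d)/w(d))·Σ_{e ∣ n′} μ(e)·(d∕e)·σ₁(n′/e)`, `n′` the prime-to-`6` part of the conductor

[tag: complex_torus] [tag: abelian_surface] [tag: quaternion_multiplication] [tag: complex_multiplication]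
[tag: shimura_curve] [tag: special_cycles] [tag: class_number] [tag: modular_form]

Lane `lit-hodgefound`, seat p12, row g42-#3 — THEOREMS ONLY (no definition, no named fact, no instance). The second
printed form of [KRY] (3.4.6) (`…XSixKRYDegreeFormulaSecondForm`, row g41-#3) has the inner sum
`S_d(n) = Σ_{c ∣ n, (c,6)=1} c·∏_{ℓ∣c}(1 − χ_d(ℓ)ℓ⁻¹)`; row g42-#1 (`QuadraticFields/HurwitzClassNumberConductorSum`)
proved, for any `χ`, `Σ_{c ∣ F} c∏_{p∣c}(1 − χ(p)/p) = Σ_{e ∣ F} μ(e)·(∏_{p∣e}χ(p))·σ₁(F/e)` (the divisor sum of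
`(μχ) * id` is `(μχ) * σ₁`). This file rewrites `S_d` accordingly — first discarding the primes `2, 3`
(`S_d(n) = S_d(n′)`, `n′ = n/(2^{v₂(n)}3^{v₃(n)})`, by the multiplicativity of row g41-#5) — and so puts the degree
of the special cycles in the shape of the Fourier coefficients of Cohen's/Zagier's weight-`3/2` Eisenstein series,
`H(N) = L(0, χ_d)·Σ_{e∣f} μ(e)χ_d(e)σ₁(f/e)`: for every `t > 0`,
`deg Z(t)_ℚ = 2δ(d; 6)·(h(d)/w(d))·Σ_{e ∣ n′} μ(e)·(d∕e)·σ₁(n′/e)` (`(d∕e)` the Jacobi symbol — `n′` is odd).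
Notation as in the sibling files (`t` is `m` in the code, `n = F = conductor 0 t`, `d = d_K = t_F² − 4n_F`,
`δ(d; 6) = (1 − χ₈(d))(1 − (d∕3))`, `deg Z(t)_ℚ = 2·Σᶠ_{[x] ∈ L(t)/O₆^×} e_x⁻¹`).

## The print

* S. Kudla, M. Rapoport, T. Yang, *Modular Forms and Special Cycles on Shimura Curves* (2006), §3.4 p. 45 (held
  p0053): (3.4.4)–(3.4.6) «`H₀(t, D) = Σ_{c∣n} h(c²d)/w(c²d) = (h(d)/w(d))·(Σ_{c∣n, (c,D)=1} c·∏_{ℓ∣c}(1 −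
  χ_d(ℓ)ℓ⁻¹))`», (3.4.14); Ch. 1 pp. vii, 2 (held p0007, p0010): Zagier's `ℰ(τ, ½) = −1/12 + Σ_{t>0} H(4t)q^t + …`
  and Prop. 1.0.2 `φ₁(τ) = ℰ₁(τ, ½, B)`. [cite: KudlaRapoportYang2006, §3.4 (3.4.4)–(3.4.6), (3.4.14) and Ch. 1 Prop. 1.0.1–1.0.2]
* H. Cohen, *A Course in Computational Algebraic Number Theory* (1993), §5.3.2 Lemma 5.3.7 (p. 234, held p0286).
  [cite: Cohen1993, §5.3.2 Lemma 5.3.7, p. 234]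
* T. M. Apostol, *Introduction to Analytic Number Theory* (1976), Thm. 2.18 (p. 37, held p0036).
  [cite: Apostol1976, §2.11 Thm. 2.18, p. 37]
* D. A. Cox, *Primes of the form x² + ny²*, 2nd ed. (2013), Thm. 7.24 / Cor. 7.28 and the Kronecker symbol
  (§7.D p. 146). [cite: Cox2013, §7.D Thm. 7.24 and Cor. 7.28, pp. 146–148]

## What is proved

* §1 `prod_primeFactors_jacobiSym_of_squarefree` (`∏_{ℓ∣e}(a∕ℓ) = (a∕e)` for squarefree `e`);
  **`sum_psi_eq_sum_moebius_jacobiSym_sigma`** (`(N, 6) = 1`: `S_d(N) = Σ_{e∣N} μ(e)(d∕e)σ₁(N/e)`).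
* §2 `coprime_six_div_ordProj` (`n′ = n/(2^{v₂n}3^{v₃n})` is coprime to `6`), `eq_ordProj_mul_div`
  (`n = 2^{v₂}3^{v₃}·n′`), **`sum_psi_eq_sum_divisors_sixFree`** (`S_d(n) = Σ_{c∣n′} Ψ_d(c)`),
  **`sum_psi_eq_sum_moebius_sixFree`** (`S_d(n) = Σ_{e∣n′} μ(e)(d∕e)σ₁(n′/e)`, every `n ≥ 1`).
* §3 **`kry_degree_formula_moebius`** (`(n, 6) = 1`), `kry_degree_formula_moebius_of_mod_four`
  (`t ≡ 1, 2 (mod 4)`, `9 ∤ t`), **`kry_degree_formula_moebius_sixFree`** (EVERY `t > 0`, over `n′`).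
* §4 a new value by kernel evaluation of the Möbius form: **`degree_sixhundredthirtyseven`** (`t = 637 = 13·7²`:
  `n = 7`, `d = −52`, `δ = 2`, `h(−52)/w = 2/2`, `σ₁(7) − (−52∕7) = 8 − 1 = 7`, `deg Z(637)_ℚ = 2·2·1·7 = 28`).

## Scope (honest)

Only `D(B) = 6`. No Eisenstein series or `L`-value is defined; `L(0, χ_d) = 2h(d)/w(d)` and the identification
with Cohen's `H(N)` coefficients are commentary (the `(n,6) = 1` case IS `δ·H(4t)` by row g42-#2's
`kry_degree_formula_hurwitz`).
-/

set_option maxSynthPendingDepth 3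

open Quaternion Function
open scoped Pointwise
open Literature.NumberTheory.Automorphic Literature.NumberTheory.Automorphic.Brandt
open Literature.NumberTheory.Automorphic.HeckeTraceFormulaGL2Level (ellipticConductors weightedClassNumber)
open Literature.NumberTheory.QuadraticFields.Quadratic (BinQF.classNumber)
open Literature.NumberTheory.QuadraticFields (sum_divisors_mul_prod_one_sub_div_eq_sum_moebius_sigma)

namespace Literature.Geometry.Kaehler.ComplexTorus.QuaternionType

/-! ## §1 `S_d(N) = Σ_{e ∣ N} μ(e)(d∕e)σ₁(N/e)` for `(N, 6) = 1` -/

section MoebiusSigma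

/-- For SQUAREFREE `e`, `∏_{ℓ ∣ e}(a∕ℓ) = (a∕e)` (the Jacobi symbol is multiplicative in its lower argument and
`e = ∏_{ℓ∣e} ℓ`). [cite: Cox2013, §7.D (the Kronecker symbol, display before Thm. 7.24), p. 146] -/
theorem prod_primeFactors_jacobiSym_of_squarefree (a : ℤ) {e : ℕ} (hsq : Squarefree e) :
    ∏ ℓ ∈ e.primeFactors, jacobiSym a ℓ = jacobiSym a e := by
  classical
  conv_rhs => rw [← Nat.prod_primeFactors_of_squarefree hsq]
  have key : ∀ s : Finset ℕ, (∀ p ∈ s, p.Prime) → ∏ p ∈ s, jacobiSym a p = jacobiSym a (∏ p ∈ s, p) := by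
    intro s
    induction s using Finset.induction_on with
    | empty => intro _; simp [jacobiSym.one_right]
    | insert b s hb ih =>
      intro hs
      have hbpr : b.Prime := hs b (Finset.mem_insert_self b s)
      have hs' : ∀ p ∈ s, p.Prime := fun p hp ↦ hs p (Finset.mem_insert_of_mem hp)
      haveI : NeZero b := ⟨hbpr.ne_zero⟩
      haveI : NeZero (∏ p ∈ s, p) := ⟨Finset.prod_ne_zero_iff.2 fun p hp ↦ (hs' p hp).ne_zero⟩
      rw [Finset.prod_insert hb, Finset.prod_insert hb, ih hs', jacobiSym.mul_right]
  exact key _ fun p hp ↦ Nat.prime_of_mem_primeFactors hp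

/-- **THE INNER SUM OF (3.4.6) IN `μ·σ₁` FORM** for `N` coprime to `6`:
`Σ_{c ∣ N, (c,6)=1} c·∏_{ℓ∣c}(1 − (d∕ℓ)ℓ⁻¹) = Σ_{e ∣ N} μ(e)·(d∕e)·σ₁(N/e)` — row g42-#1's
`(μχ) * id * ζ = (μχ) * σ₁` with `χ = (d∕·)`, the product symbol being the Jacobi symbol on the squarefree `e`.
[cite: KudlaRapoportYang2006, §3.4 (3.4.6)] [cite: Apostol1976, §2.11 Thm. 2.18, p. 37] [cite: Cohen1993, §5.3.2 Lemma 5.3.7, p. 234] -/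
theorem sum_psi_eq_sum_moebius_jacobiSym_sigma (d : ℤ) {N : ℕ} (h6 : N.Coprime 6) :
    ∑ c ∈ (N.divisors.filter fun c : ℕ => c.Coprime 6), ((c : ℚ) * ∏ ℓ ∈ (c : ℕ).primeFactors, (1 - (jacobiSym d ℓ : ℚ) / ℓ)) =
      ∑ e ∈ N.divisors, (ArithmeticFunction.moebius e : ℚ) * jacobiSym d e * (ArithmeticFunction.sigma 1 (N / e) : ℚ) := by
  rw [Finset.filter_true_of_mem fun c hc ↦ Nat.Coprime.coprime_dvd_left (Nat.dvd_of_mem_divisors hc) h6]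
  have key := sum_divisors_mul_prod_one_sub_div_eq_sum_moebius_sigma (fun ℓ ↦ jacobiSym d ℓ) N
  beta_reduce at key
  rw [key]
  refine Finset.sum_congr rfl fun e _ ↦ ?_
  by_cases hsq : Squarefree e
  · rw [← Int.cast_prod, prod_primeFactors_jacobiSym_of_squarefree d hsq]
  · rw [ArithmeticFunction.moebius_eq_zero_of_not_squarefree hsq]
    simp

end MoebiusSigma

/-! ## §2 Discarding the primes `2, 3`: `S_d(n) = S_d(n′)`, `n′ = n/(2^{v₂(n)}·3^{v₃(n)})` -/

section SixFree

/-- `n′ = n/(2^{v₂(n)}3^{v₃(n)})` is coprime to `6` (`n ≥ 1`). [folklore] [cite: KudlaRapoportYang2006, §3.4 (3.4.6)] -/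
theorem coprime_six_div_ordProj {N : ℕ} (hN : N ≠ 0) :
    (N / (2 ^ N.factorization 2 * 3 ^ N.factorization 3)).Coprime 6 := by
  have h23 : (2 ^ N.factorization 2).Coprime (3 ^ N.factorization 3) :=
    Nat.coprime_pow_primes _ _ Nat.prime_two Nat.prime_three (by norm_num)
  have hdvd : 2 ^ N.factorization 2 * 3 ^ N.factorization 3 ∣ N :=
    Nat.Coprime.mul_dvd_of_dvd_of_dvd h23 (Nat.ordProj_dvd N 2) (Nat.ordProj_dvd N 3)
  set N' := N / (2 ^ N.factorization 2 * 3 ^ N.factorization 3) with hN'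
  have hN_eq : N = 2 ^ N.factorization 2 * 3 ^ N.factorization 3 * N' := (Nat.mul_div_cancel' hdvd).symm.trans (by rw [hN'])
  have h2 : ¬ 2 ∣ N' := by
    rintro ⟨k, hk⟩
    apply Nat.pow_succ_factorization_not_dvd hN Nat.prime_two
    refine ⟨3 ^ N.factorization 3 * k, ?_⟩
    conv_lhs => rw [hN_eq, hk]
    ring
  have h3 : ¬ 3 ∣ N' := by
    rintro ⟨k, hk⟩
    apply Nat.pow_succ_factorization_not_dvd hN Nat.prime_three
    refine ⟨2 ^ N.factorization 2 * k, ?_⟩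
    conv_lhs => rw [hN_eq, hk]
    ring
  rw [show (6 : ℕ) = 2 * 3 by norm_num, Nat.coprime_mul_iff_right,
    Nat.coprime_comm (n := N'), Nat.prime_two.coprime_iff_not_dvd,
    Nat.coprime_comm (n := N'), Nat.prime_three.coprime_iff_not_dvd]
  exact ⟨h2, h3⟩

/-- `n = 2^{v₂(n)}·3^{v₃(n)}·n′` (every `n`; at `n = 0` both sides vanish). [folklore] [cite: KudlaRapoportYang2006, §3.4 (3.4.6)] -/
theorem eq_ordProj_mul_div (N : ℕ) :
    N = 2 ^ N.factorization 2 * 3 ^ N.factorization 3 * (N / (2 ^ N.factorization 2 * 3 ^ N.factorization 3)) := by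
  have h23 : (2 ^ N.factorization 2).Coprime (3 ^ N.factorization 3) :=
    Nat.coprime_pow_primes _ _ Nat.prime_two Nat.prime_three (by norm_num)
  have hdvd : 2 ^ N.factorization 2 * 3 ^ N.factorization 3 ∣ N :=
    Nat.Coprime.mul_dvd_of_dvd_of_dvd h23 (Nat.ordProj_dvd N 2) (Nat.ordProj_dvd N 3)
  exact (Nat.mul_div_cancel' hdvd).symm

/-- **`S_d(n) = Σ_{c ∣ n′} c∏_{ℓ∣c}(1 − (d∕ℓ)ℓ⁻¹)`**, `n′ = n/(2^{v₂(n)}3^{v₃(n)})` (`n ≥ 1`): the local factors of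
the multiplicative `S_d` at `2` and `3` are `1` (row g41-#5), and on the divisors of `n′` the condition `(c, 6) = 1`
is void. [cite: KudlaRapoportYang2006, §3.4 (3.4.6)] [cite: Cox2013, §7.D Thm. 7.24, p. 146] -/
theorem sum_psi_eq_sum_divisors_sixFree (d : ℤ) {N : ℕ} (hN : N ≠ 0) :
    ∑ c ∈ (N.divisors.filter fun c : ℕ => c.Coprime 6), ((c : ℚ) * ∏ ℓ ∈ (c : ℕ).primeFactors, (1 - (jacobiSym d ℓ : ℚ) / ℓ)) =
      ∑ c ∈ (N / (2 ^ N.factorization 2 * 3 ^ N.factorization 3)).divisors,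
        ((c : ℚ) * ∏ ℓ ∈ (c : ℕ).primeFactors, (1 - (jacobiSym d ℓ : ℚ) / ℓ)) := by
  have h6 := coprime_six_div_ordProj hN
  set N' := N / (2 ^ N.factorization 2 * 3 ^ N.factorization 3) with hN'
  have hN_eq := eq_ordProj_mul_div N
  rw [← hN'] at hN_eq
  -- coprimality of the three factors
  have h23 : (2 ^ N.factorization 2).Coprime (3 ^ N.factorization 3) :=
    Nat.coprime_pow_primes _ _ Nat.prime_two Nat.prime_three (by norm_num)
  have h2N' : (2 ^ N.factorization 2).Coprime N' :=
    Nat.Coprime.pow_left _ (Nat.Coprime.coprime_dvd_right (by norm_num : 2 ∣ 6) h6).symm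
  have h3N' : (3 ^ N.factorization 3).Coprime N' :=
    Nat.Coprime.pow_left _ (Nat.Coprime.coprime_dvd_right (by norm_num : 3 ∣ 6) h6).symm
  have h23N' : (2 ^ N.factorization 2 * 3 ^ N.factorization 3).Coprime N' := Nat.Coprime.mul_left h2N' h3N'
  conv_lhs => rw [hN_eq]
  rw [sum_psi_mul_of_coprime d h23N', sum_psi_mul_of_coprime d h23,
    sum_psi_prime_pow_of_dvd_six d Nat.prime_two (by norm_num), sum_psi_prime_pow_of_dvd_six d Nat.prime_three (by norm_num),
    one_mul, one_mul, Finset.filter_true_of_mem fun c hc ↦ Nat.Coprime.coprime_dvd_left (Nat.dvd_of_mem_divisors hc) h6]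

/-- **`S_d(n) = Σ_{e ∣ n′} μ(e)·(d∕e)·σ₁(n′/e)`** for EVERY `n ≥ 1` (`n′` the prime-to-`6` part of `n`).
[cite: KudlaRapoportYang2006, §3.4 (3.4.6)] [cite: Apostol1976, §2.11 Thm. 2.18, p. 37] [cite: Cohen1993, §5.3.2 Lemma 5.3.7, p. 234] -/
theorem sum_psi_eq_sum_moebius_sixFree (d : ℤ) {N : ℕ} (hN : N ≠ 0) :
    ∑ c ∈ (N.divisors.filter fun c : ℕ => c.Coprime 6), ((c : ℚ) * ∏ ℓ ∈ (c : ℕ).primeFactors, (1 - (jacobiSym d ℓ : ℚ) / ℓ)) =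
      ∑ e ∈ (N / (2 ^ N.factorization 2 * 3 ^ N.factorization 3)).divisors,
        (ArithmeticFunction.moebius e : ℚ) * jacobiSym d e *
          (ArithmeticFunction.sigma 1 (N / (2 ^ N.factorization 2 * 3 ^ N.factorization 3) / e) : ℚ) := by
  rw [sum_psi_eq_sum_divisors_sixFree d hN, ← sum_psi_eq_sum_moebius_jacobiSym_sigma d (coprime_six_div_ordProj hN),
    Finset.filter_true_of_mem fun c hc ↦
      Nat.Coprime.coprime_dvd_left (Nat.dvd_of_mem_divisors hc) (coprime_six_div_ordProj hN)]

end SixFree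

/-! ## §3 The degree formula in Cohen's `μ·σ₁` form -/

section Degree

/-- **KRY's DEGREE FORMULA IN COHEN's `μ·σ₁` FORM, `(n, 6) = 1`**: if the conductor `n = F` of `ℤ[√−t]` is coprime
to `6`, `deg Z(t)_ℚ = 2δ(d; 6)·(h(d)/w(d))·Σ_{e ∣ n} μ(e)·(d∕e)·σ₁(n/e)` — the coefficient shape of Cohen's/Zagier's
weight-`3/2` Eisenstein series (`H(N) = L(0, χ_d)Σ_{e∣f} μ(e)χ_d(e)σ₁(f/e)`), of which `φ₁ = ℰ₁(τ, ½, B)` is KRY's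
analogue for `X₆`. [cite: KudlaRapoportYang2006, §3.4 (3.4.4)–(3.4.6), (3.4.14) and Ch. 1 Prop. 1.0.1–1.0.2]
[cite: Cohen1993, §5.3.2 Lemma 5.3.7, p. 234] [cite: Apostol1976, §2.11 Thm. 2.18, p. 37] -/
theorem kry_degree_formula_moebius {m : ℕ} (hm : 0 < m) (h6 : (conductor 0 m).Coprime 6) :
    2 * ∑ᶠ q : (Quot (fun x y : {x : ℤ × ℤ × ℤ // x.1 ^ 2 - 3 * x.2.1 ^ 2 - 3 * x.2.2 ^ 2 = (m : ℤ)} ↦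
      ∃ v : ℍ[ℚ,((-1 : ℤ) : ℚ),((3 : ℤ) : ℚ)], (v ∈ order (-1) 3 ∨ v - ⟨1/2, 1/2, 1/2, -1/2⟩ ∈ order (-1) 3) ∧
        ((v * star v).re = 1 ∨ (v * star v).re = -1) ∧
        v * ⟨0, x.1.1, x.1.2.1, x.1.2.2⟩ = ⟨0, y.1.1, y.1.2.1, y.1.2.2⟩ * v)),
        ((Nat.card
          {u : ℍ[ℚ,((-1 : ℤ) : ℚ),((3 : ℤ) : ℚ)] // (u ∈ order (-1) 3 ∨ u - ⟨1/2, 1/2, 1/2, -1/2⟩ ∈ order (-1) 3) ∧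
            ((u * star u).re = 1 ∨ (u * star u).re = -1) ∧
            u * ⟨0, q.out.1.1, q.out.1.2.1, q.out.1.2.2⟩ = ⟨0, q.out.1.1, q.out.1.2.1, q.out.1.2.2⟩ * u} : ℚ))⁻¹ =
      2 * ((((1 - ZMod.χ₈ ((((tOf 0 m (conductor 0 m) ^ 2 - 4 * nOf 0 m (conductor 0 m)) : ℤ)) : ZMod 8)) * (1 - legendreSym 3 (tOf 0 m (conductor 0 m) ^ 2 - 4 * nOf 0 m (conductor 0 m)))) : ℤ) : ℚ) *
        ((BinQF.classNumber (tOf 0 m (conductor 0 m) ^ 2 - 4 * nOf 0 m (conductor 0 m)) : ℚ) / unitsOfDisc (tOf 0 m (conductor 0 m) ^ 2 - 4 * nOf 0 m (conductor 0 m)) *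
          ∑ e ∈ (conductor 0 m).divisors, (ArithmeticFunction.moebius e : ℚ) * jacobiSym (tOf 0 m (conductor 0 m) ^ 2 - 4 * nOf 0 m (conductor 0 m)) e *
            (ArithmeticFunction.sigma 1 (conductor 0 m / e) : ℚ)) := by
  rw [kry_degree_formula_second_form hm, sum_psi_eq_sum_moebius_jacobiSym_sigma _ h6]

/-- The same under **`t ≡ 1, 2 (mod 4)` and `9 ∤ t`** (⟺ `(n, 6) = 1`, `conductor_coprime_six_iff`).
[cite: KudlaRapoportYang2006, §3.4 (3.4.4)–(3.4.6), (3.4.14)] [cite: Cohen1993, §5.3.2 Lemma 5.3.7, p. 234] -/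
theorem kry_degree_formula_moebius_of_mod_four {m : ℕ} (hm : 0 < m) (h4 : m % 4 = 1 ∨ m % 4 = 2)
    (h9 : ¬ 9 ∣ m) :
    2 * ∑ᶠ q : (Quot (fun x y : {x : ℤ × ℤ × ℤ // x.1 ^ 2 - 3 * x.2.1 ^ 2 - 3 * x.2.2 ^ 2 = (m : ℤ)} ↦
      ∃ v : ℍ[ℚ,((-1 : ℤ) : ℚ),((3 : ℤ) : ℚ)], (v ∈ order (-1) 3 ∨ v - ⟨1/2, 1/2, 1/2, -1/2⟩ ∈ order (-1) 3) ∧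
        ((v * star v).re = 1 ∨ (v * star v).re = -1) ∧
        v * ⟨0, x.1.1, x.1.2.1, x.1.2.2⟩ = ⟨0, y.1.1, y.1.2.1, y.1.2.2⟩ * v)),
        ((Nat.card
          {u : ℍ[ℚ,((-1 : ℤ) : ℚ),((3 : ℤ) : ℚ)] // (u ∈ order (-1) 3 ∨ u - ⟨1/2, 1/2, 1/2, -1/2⟩ ∈ order (-1) 3) ∧
            ((u * star u).re = 1 ∨ (u * star u).re = -1) ∧
            u * ⟨0, q.out.1.1, q.out.1.2.1, q.out.1.2.2⟩ = ⟨0, q.out.1.1, q.out.1.2.1, q.out.1.2.2⟩ * u} : ℚ))⁻¹ =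
      2 * ((((1 - ZMod.χ₈ ((((tOf 0 m (conductor 0 m) ^ 2 - 4 * nOf 0 m (conductor 0 m)) : ℤ)) : ZMod 8)) * (1 - legendreSym 3 (tOf 0 m (conductor 0 m) ^ 2 - 4 * nOf 0 m (conductor 0 m)))) : ℤ) : ℚ) *
        ((BinQF.classNumber (tOf 0 m (conductor 0 m) ^ 2 - 4 * nOf 0 m (conductor 0 m)) : ℚ) / unitsOfDisc (tOf 0 m (conductor 0 m) ^ 2 - 4 * nOf 0 m (conductor 0 m)) *
          ∑ e ∈ (conductor 0 m).divisors, (ArithmeticFunction.moebius e : ℚ) * jacobiSym (tOf 0 m (conductor 0 m) ^ 2 - 4 * nOf 0 m (conductor 0 m)) e *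
            (ArithmeticFunction.sigma 1 (conductor 0 m / e) : ℚ)) :=
  kry_degree_formula_moebius hm ((conductor_coprime_six_iff hm).2 ⟨h4, h9⟩)

/-- **KRY's DEGREE FORMULA IN `μ·σ₁` FORM FOR EVERY `t > 0`**: with `n′ = n/(2^{v₂(n)}3^{v₃(n)})` the prime-to-`6`
part of the conductor, `deg Z(t)_ℚ = 2δ(d; 6)·(h(d)/w(d))·Σ_{e ∣ n′} μ(e)·(d∕e)·σ₁(n′/e)`.
[cite: KudlaRapoportYang2006, §3.4 (3.4.4)–(3.4.6), (3.4.14)] [cite: Cohen1993, §5.3.2 Lemma 5.3.7, p. 234]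
[cite: Apostol1976, §2.11 Thm. 2.18, p. 37] -/
theorem kry_degree_formula_moebius_sixFree {m : ℕ} (hm : 0 < m) :
    2 * ∑ᶠ q : (Quot (fun x y : {x : ℤ × ℤ × ℤ // x.1 ^ 2 - 3 * x.2.1 ^ 2 - 3 * x.2.2 ^ 2 = (m : ℤ)} ↦
      ∃ v : ℍ[ℚ,((-1 : ℤ) : ℚ),((3 : ℤ) : ℚ)], (v ∈ order (-1) 3 ∨ v - ⟨1/2, 1/2, 1/2, -1/2⟩ ∈ order (-1) 3) ∧
        ((v * star v).re = 1 ∨ (v * star v).re = -1) ∧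
        v * ⟨0, x.1.1, x.1.2.1, x.1.2.2⟩ = ⟨0, y.1.1, y.1.2.1, y.1.2.2⟩ * v)),
        ((Nat.card
          {u : ℍ[ℚ,((-1 : ℤ) : ℚ),((3 : ℤ) : ℚ)] // (u ∈ order (-1) 3 ∨ u - ⟨1/2, 1/2, 1/2, -1/2⟩ ∈ order (-1) 3) ∧
            ((u * star u).re = 1 ∨ (u * star u).re = -1) ∧
            u * ⟨0, q.out.1.1, q.out.1.2.1, q.out.1.2.2⟩ = ⟨0, q.out.1.1, q.out.1.2.1, q.out.1.2.2⟩ * u} : ℚ))⁻¹ =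
      2 * ((((1 - ZMod.χ₈ ((((tOf 0 m (conductor 0 m) ^ 2 - 4 * nOf 0 m (conductor 0 m)) : ℤ)) : ZMod 8)) * (1 - legendreSym 3 (tOf 0 m (conductor 0 m) ^ 2 - 4 * nOf 0 m (conductor 0 m)))) : ℤ) : ℚ) *
        ((BinQF.classNumber (tOf 0 m (conductor 0 m) ^ 2 - 4 * nOf 0 m (conductor 0 m)) : ℚ) / unitsOfDisc (tOf 0 m (conductor 0 m) ^ 2 - 4 * nOf 0 m (conductor 0 m)) *
          ∑ e ∈ (conductor 0 m / (2 ^ (conductor 0 m).factorization 2 * 3 ^ (conductor 0 m).factorization 3)).divisors,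
            (ArithmeticFunction.moebius e : ℚ) * jacobiSym (tOf 0 m (conductor 0 m) ^ 2 - 4 * nOf 0 m (conductor 0 m)) e *
              (ArithmeticFunction.sigma 1
                (conductor 0 m / (2 ^ (conductor 0 m).factorization 2 * 3 ^ (conductor 0 m).factorization 3) / e) : ℚ)) := by
  rw [kry_degree_formula_second_form hm,
    sum_psi_eq_sum_moebius_sixFree _ (conductor_pos (show (0 : ℤ) ^ 2 < 4 * m by positivity)).ne']

end Degree

/-! ## §4 A value by kernel evaluation of the Möbius form: `deg Z(637)_ℚ = 28` -/

section Values

/-- **`deg Z(637)_ℚ = 28`** (new row; `637 = 13·7² ≡ 1 (mod 4)`, `9 ∤ 637`): `n = 7`, `d = −52`, `χ₈(−52) = 0`,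
`(−52∕3) = −1`, `δ = 2`, `h(−52) = 2 = w(−52)`, `Σ_{e∣7} μ(e)(−52∕e)σ₁(7/e) = 8 − (−52∕7) = 7`, so
`deg = 2·2·1·7 = 28` (consistent with the Hurwitz form: `H(2548) = h_w(−52)·(1 + 7 − 1) = 14`, `δ·H = 28`).
[cite: KudlaRapoportYang2006, §3.4 (3.4.4)–(3.4.6) and (3.4.14)] [cite: Cohen1993, Appendix B Table B.1 (d, h(d), H(−d))] -/
theorem degree_sixhundredthirtyseven : 2 * ∑ᶠ q : (Quot (fun x y : {x : ℤ × ℤ × ℤ // x.1 ^ 2 - 3 * x.2.1 ^ 2 - 3 * x.2.2 ^ 2 = (637 : ℤ)} ↦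
      ∃ v : ℍ[ℚ,((-1 : ℤ) : ℚ),((3 : ℤ) : ℚ)], (v ∈ order (-1) 3 ∨ v - ⟨1/2, 1/2, 1/2, -1/2⟩ ∈ order (-1) 3) ∧
        ((v * star v).re = 1 ∨ (v * star v).re = -1) ∧
        v * ⟨0, x.1.1, x.1.2.1, x.1.2.2⟩ = ⟨0, y.1.1, y.1.2.1, y.1.2.2⟩ * v)),
        ((Nat.card
          {u : ℍ[ℚ,((-1 : ℤ) : ℚ),((3 : ℤ) : ℚ)] // (u ∈ order (-1) 3 ∨ u - ⟨1/2, 1/2, 1/2, -1/2⟩ ∈ order (-1) 3) ∧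
            ((u * star u).re = 1 ∨ (u * star u).re = -1) ∧
            u * ⟨0, q.out.1.1, q.out.1.2.1, q.out.1.2.2⟩ = ⟨0, q.out.1.1, q.out.1.2.1, q.out.1.2.2⟩ * u} : ℚ))⁻¹ = 28 := by
  have e : 2 * ∑ᶠ q : (Quot (fun x y : {x : ℤ × ℤ × ℤ // x.1 ^ 2 - 3 * x.2.1 ^ 2 - 3 * x.2.2 ^ 2 = (637 : ℤ)} ↦
      ∃ v : ℍ[ℚ,((-1 : ℤ) : ℚ),((3 : ℤ) : ℚ)], (v ∈ order (-1) 3 ∨ v - ⟨1/2, 1/2, 1/2, -1/2⟩ ∈ order (-1) 3) ∧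
        ((v * star v).re = 1 ∨ (v * star v).re = -1) ∧
        v * ⟨0, x.1.1, x.1.2.1, x.1.2.2⟩ = ⟨0, y.1.1, y.1.2.1, y.1.2.2⟩ * v)),
        ((Nat.card
          {u : ℍ[ℚ,((-1 : ℤ) : ℚ),((3 : ℤ) : ℚ)] // (u ∈ order (-1) 3 ∨ u - ⟨1/2, 1/2, 1/2, -1/2⟩ ∈ order (-1) 3) ∧
            ((u * star u).re = 1 ∨ (u * star u).re = -1) ∧
            u * ⟨0, q.out.1.1, q.out.1.2.1, q.out.1.2.2⟩ = ⟨0, q.out.1.1, q.out.1.2.1, q.out.1.2.2⟩ * u} : ℚ))⁻¹ = 2 * ∑ᶠ q : (Quot (fun x y : {x : ℤ × ℤ × ℤ // x.1 ^ 2 - 3 * x.2.1 ^ 2 - 3 * x.2.2 ^ 2 = ((637 : ℕ) : ℤ)} ↦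
      ∃ v : ℍ[ℚ,((-1 : ℤ) : ℚ),((3 : ℤ) : ℚ)], (v ∈ order (-1) 3 ∨ v - ⟨1/2, 1/2, 1/2, -1/2⟩ ∈ order (-1) 3) ∧
        ((v * star v).re = 1 ∨ (v * star v).re = -1) ∧
        v * ⟨0, x.1.1, x.1.2.1, x.1.2.2⟩ = ⟨0, y.1.1, y.1.2.1, y.1.2.2⟩ * v)),
        ((Nat.card
          {u : ℍ[ℚ,((-1 : ℤ) : ℚ),((3 : ℤ) : ℚ)] // (u ∈ order (-1) 3 ∨ u - ⟨1/2, 1/2, 1/2, -1/2⟩ ∈ order (-1) 3) ∧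
            ((u * star u).re = 1 ∨ (u * star u).re = -1) ∧
            u * ⟨0, q.out.1.1, q.out.1.2.1, q.out.1.2.2⟩ = ⟨0, q.out.1.1, q.out.1.2.1, q.out.1.2.2⟩ * u} : ℚ))⁻¹ := rfl
  rw [e, kry_degree_formula_moebius_of_mod_four (by norm_num : 0 < 637) (by norm_num) (by norm_num),
    disc_conductor_eq_div (by norm_num : 0 < 637)]
  decide +kernel

end Values

end Literature.Geometry.Kaehler.ComplexTorus.QuaternionType
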